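import Literature.Computability.QuantumComplexity.ZXCalculusTriangleNode
import HarnessLib

/-!
# `ZX_{π/4}` modulo the calculus: lemmas on the triangle node (Appendix Lemmas 28–37)

Topic `Literature/Computability/QuantumComplexity`, continuing `ZXCalculusTriangleNode.lean`
(layer T6 of the formalisation of `JeandelPerdrixVilmart2018_completeness`).

* the plugged bialgebra (`four_cycle`): a green copy, a leafy red node and a green phase on one
  branch, and a red merge — a green–red `4`-cycle — contract by (B2):
  `√2 ⊗ (Z^{(1,2)} ⨾ ((X^{(1,2)} ⨾ (E ⊗ 𝕀) ⨾ Z(c)) ⊗ 𝕀) ⨾ X^{(2,1)}) = xLeafL 0 c ⨾ Z^{(1,2)} ⨾ (E ⊗ 𝕀)`;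
* **Appendix Lemma 29** (`looped-triangle`): `√2 ⊗ (Z^{(1,2)} ⨾ (T ⊗ 𝕀) ⨾ X^{(2,1)}) = T`.

## References

* E. Jeandel, S. Perdrix, R. Vilmart, LICS 2018 (arXiv:1705.11151v2), Fig. 1 (B2)
  [JeandelPerdrixVilmart2018].
* E. Jeandel, S. Perdrix, R. Vilmart, *A Complete Axiomatisation of the ZX-Calculus for Clifford+T Quantum
  Mechanics*, LICS 2018, arXiv:1705.11151 (v2), Appendix, Lemmas 28–37 [JeandelPerdrixVilmart2018].
-/

noncomputable section

namespace Literature.Computability.QuantumComplexity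

open ZXDiagram ZXClass

namespace ZXClass

/-! ### Wiring tools -/

/-- A wire crossing one leg of a cup crosses the other leg instead:
`(𝕀 ⊗ η) ⨾ (σ ⊗ 𝕀) = (η ⊗ 𝕀) ⨾ (𝕀 ⊗ σ)`. [cite: JeandelPerdrixVilmart2018, §2.2] -/
theorem par_cup_swap_par : (mk (wires 1) ⊠ mk cup) ⨟ (mk swap ⊠ mk (wires 1)) = (mk cup ⊠ mk (wires 1)) ⨟ (mk (wires 1) ⊠ mk swap) := by
  have h := wires_par_seq_fswap1 (mk cup)
  rw [fswap1_two, fswap1_zero, ← seq_assoc] at h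
  have h' := congrArg (· ⨟ (mk (wires 1) ⊠ mk swap)) h
  simp only [seq_assoc, ← wires_par_seq, swap_seq_swap, wires_par_wires] at h'
  rw [seq_id] at h'
  rw [h', id_seq]

/-- A phase crosses a swap: `σ ⨾ (𝕀 ⊗ Z(c)) = (Z(c) ⊗ 𝕀) ⨾ σ`. [cite: JeandelPerdrixVilmart2018, §2.2] -/
theorem swap_seq_par_phase (P : ZXClass 1 1) : mk swap ⨟ (mk (wires 1) ⊠ P) = (P ⊠ mk (wires 1)) ⨟ mk swap := by
  have h := bswap1_seq_wires_par P
  rwa [bswap1_one] at h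

/-- The red split bent on the right: `(𝕀 ⊗ η) ⨾ (X^{(2,1)} ⊗ 𝕀) = X^{(1,2)}`. [cite: JeandelPerdrixVilmart2018, §2.2] -/
theorem par_cup_seq_xmerge_par : (mk (wires 1) ⊠ mk cup) ⨟ (mk (X 2 1 0) ⊠ mk (wires 1)) = mk (X 1 2 0) := by
  have h := congrArg colorSwap par_cup_seq_merge_par
  simpa using h

/-- A green state on the second input of a red node is a leaf: `(𝕀 ⊗ Z^{(0,1)}(c)) ⨾ X^{(2,1)}(k) = xLeafL k c`.
[cite: JeandelPerdrixVilmart2018, §2.2] -/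
theorem par_Z_state_seq_X_merge (c k : ZMod 8) : (mk (wires 1) ⊠ mk (Z 0 1 c)) ⨟ mk (X 2 1 k) = mk (xLeafL k c) := by
  rw [← swap_seq_X 1 k, ← seq_assoc, par_state_seq_swap, Z_state_par_seq_X_merge]

/-- The green phase state as a cup: `Z^{(0,2)}(c) = η ⨾ (𝕀 ⊗ Z(c))`. [cite: JeandelPerdrixVilmart2018, Fig. 1 (S1)] -/
theorem Z_zero_two_eq_cup_par_phase (c : ZMod 8) : mk (Z 0 2 c) = mk cup ⨟ (mk (wires 1) ⊠ mk (Z 1 1 c)) := by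
  rw [← Z_zero_two, Z_seq_par_Z 0 1 1 1 le_rfl, zero_add]

/-! ### The plugged bialgebra -/

/-- **The green–red `4`-cycle contracts** ((B2) with a green state on one input and an effect on
one output): for every effect `E` and phase `c`,
`√2 ⊗ (Z^{(1,2)} ⨾ ((X^{(1,2)} ⨾ (E ⊗ 𝕀) ⨾ Z(c)) ⊗ 𝕀) ⨾ X^{(2,1)}) = xLeafL 0 c ⨾ Z^{(1,2)} ⨾ (E ⊗ 𝕀)`.
[cite: JeandelPerdrixVilmart2018, Fig. 1 (B2)] -/
theorem four_cycle (c : ZMod 8) (E : ZXClass 1 0) :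
    mk (dumbbell 0 0) ⊠ (mk (Z 1 2 0) ⨟ ((mk (X 1 2 0) ⨟ (E ⊠ mk (wires 1)) ⨟ mk (Z 1 1 c)) ⊠ mk (wires 1)) ⨟ mk (X 2 1 0)) =
      mk (xLeafL 0 c) ⨟ mk (Z 1 2 0) ⨟ (E ⊠ mk (wires 1)) := by
  -- (B2) plugged with the state `Z^{(0,1)}(c)` on its second input and the effect `E` on its first output
  have hB : mk (dumbbell 0 0) ⊠ (((mk (wires 1) ⊠ mk (Z 0 1 c)) ⨟ ((mk (Z 1 2 0) ⊠ mk (Z 1 2 0)) ⨟ ((mk (wires 1) ⊠ mk swap) ⊠ mk (wires 1)) ⨟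
        (mk (X 2 1 0) ⊠ mk (X 2 1 0)))) ⨟ (E ⊠ mk (wires 1))) = mk (xLeafL 0 c) ⨟ mk (Z 1 2 0) ⨟ (E ⊠ mk (wires 1)) := by
    rw [← scalar_par_one_two_seq_one, ← one_two_seq_scalar_par_two, rule_B2, ← seq_assoc, par_Z_state_seq_X_merge]
  rw [← hB]
  congr 1
  -- the wiring: unplug the cycle
  have comm1 : (mk (wires 2) ⊠ (mk (wires 1) ⊠ mk (Z 1 1 c))) ⨟ ((mk (wires 1) ⊠ mk swap) ⊠ mk (wires 1)) =
      ((mk (wires 1) ⊠ mk swap) ⊠ mk (wires 1)) ⨟ (mk (wires 2) ⊠ (mk (wires 1) ⊠ mk (Z 1 1 c))) := by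
    rw [show mk (wires 2) ⊠ (mk (wires 1) ⊠ mk (Z 1 1 c)) = mk (wires 3) ⊠ mk (Z 1 1 c) from by
        rw [← wires_par_wires 2 1]; exact (par_assoc' _ _ _).trans (cast_id _ _ _),
      interchange, interchange, id_seq, seq_id, id_seq, seq_id]
  symm
  rw [← seq_assoc, ← seq_assoc, interchange, id_seq, Z_seq_Z 0 1 2 le_rfl, add_zero c, Z_zero_two_eq_cup_par_phase,
    show mk (Z 1 2 0) ⊠ (mk cup ⨟ (mk (wires 1) ⊠ mk (Z 1 1 c))) = (mk (Z 1 2 0) ⊠ mk cup) ⨟ (mk (wires 2) ⊠ (mk (wires 1) ⊠ mk (Z 1 1 c))) from by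
      rw [interchange, seq_id],
    seq_assoc (mk (Z 1 2 0) ⊠ mk cup), comm1, ← seq_assoc (mk (Z 1 2 0) ⊠ mk cup), seq_assoc _ (mk (wires 2) ⊠ (mk (wires 1) ⊠ mk (Z 1 1 c))) (mk (X 2 1 0) ⊠ mk (X 2 1 0)),
    show (mk (wires 2) ⊠ (mk (wires 1) ⊠ mk (Z 1 1 c))) ⨟ (mk (X 2 1 0) ⊠ mk (X 2 1 0)) = mk (X 2 1 0) ⊠ ((mk (wires 1) ⊠ mk (Z 1 1 c)) ⨟ mk (X 2 1 0)) from by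
      rw [interchange, id_seq],
    seq_assoc _ (mk (X 2 1 0) ⊠ ((mk (wires 1) ⊠ mk (Z 1 1 c)) ⨟ mk (X 2 1 0))) (E ⊠ mk (wires 1)), interchange, seq_id,
    -- the cup and the crossing
    show (mk (Z 1 2 0) ⊠ mk cup) ⨟ ((mk (wires 1) ⊠ mk swap) ⊠ mk (wires 1)) = mk (Z 1 2 0) ⨟ (mk (wires 1) ⊠ (mk cup ⊠ mk (wires 1))) ⨟ (mk (wires 2) ⊠ mk swap) from by
      rw [par_eq_seq_left (mk (Z 1 2 0)) (mk cup), par_empty, seq_assoc, ← wires_par_wires 1 1,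
        show (mk (wires 1) ⊠ mk (wires 1)) ⊠ mk cup = mk (wires 1) ⊠ (mk (wires 1) ⊠ mk cup) from (par_assoc _ _ _).trans (cast_id _ _ _),
        show (mk (wires 1) ⊠ mk swap) ⊠ mk (wires 1) = mk (wires 1) ⊠ (mk swap ⊠ mk (wires 1)) from (par_assoc _ _ _).trans (cast_id _ _ _),
        ← wires_par_seq, par_cup_swap_par, wires_par_seq, seq_assoc,
        show mk (wires 1) ⊠ (mk (wires 1) ⊠ mk swap) = (mk (wires 1) ⊠ mk (wires 1)) ⊠ mk swap from (par_assoc' _ _ _).trans (cast_id _ _ _),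
        wires_par_wires],
    seq_assoc, seq_assoc, interchange (mk (wires 2)) (mk (X 2 1 0) ⨟ E) (mk swap) ((mk (wires 1) ⊠ mk (Z 1 1 c)) ⨟ mk (X 2 1 0)), id_seq,
    ← seq_assoc (mk swap), swap_seq_par_phase, seq_assoc (mk (Z 1 1 c) ⊠ mk (wires 1)), swap_seq_X,
    -- regroup so that the cup feeds the leafy red node
    show (mk (X 2 1 0) ⨟ E) ⊠ ((mk (Z 1 1 c) ⊠ mk (wires 1)) ⨟ mk (X 2 1 0)) = ((((mk (X 2 1 0) ⊠ mk (wires 1)) ⨟ (E ⊠ mk (Z 1 1 c))) ⊠ mk (wires 1))) ⨟ mk (X 2 1 0) from by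
      rw [← seq_id (mk (X 2 1 0) ⨟ E), ← interchange, empty_par, cast_id,
        show (mk (X 2 1 0) ⨟ E) ⊠ (mk (Z 1 1 c) ⊠ mk (wires 1)) = ((mk (X 2 1 0) ⨟ E) ⊠ mk (Z 1 1 c)) ⊠ mk (wires 1) from (par_assoc' _ _ _).trans (cast_id _ _ _),
        show (mk (X 2 1 0) ⨟ E) ⊠ mk (Z 1 1 c) = (mk (X 2 1 0) ⊠ mk (wires 1)) ⨟ (E ⊠ mk (Z 1 1 c)) from by rw [interchange, id_seq]],
    ← seq_assoc (mk (wires 1) ⊠ (mk cup ⊠ mk (wires 1))),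
    show mk (wires 1) ⊠ (mk cup ⊠ mk (wires 1)) = (mk (wires 1) ⊠ mk cup) ⊠ mk (wires 1) from (par_assoc' _ _ _).trans (cast_id _ _ _),
    ← seq_par_wires, ← seq_assoc (mk (wires 1) ⊠ mk cup), par_cup_seq_xmerge_par, par_eq_seq_left E (mk (Z 1 1 c)), empty_par, cast_id,
    ← seq_assoc (mk (X 1 2 0)), seq_assoc (mk (Z 1 2 0))]

/-! ### Appendix Lemma 29: the looped triangle -/

/-- The green `1 → 3` spider is symmetric in its last two legs. [cite: JeandelPerdrixVilmart2018, Fig. 1 (S1)] -/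
theorem Z_one_three_seq_par_swap : mk (Z 1 3 0) ⨟ (mk (wires 1) ⊠ mk swap) = mk (Z 1 3 0) := by
  rw [show mk (Z 1 3 0) = mk (Z 1 2 0) ⨟ (mk (wires 1) ⊠ mk (Z 1 2 0)) from by rw [Z_seq_par_Z 1 1 1 2 le_rfl, add_zero],
    seq_assoc, ← wires_par_seq, Z_seq_swap]

/-- **A green node with a gadget commutes with the copy**:
`Z^{(1,2)} ⨾ ((Z^{(1,2)} ⨾ (𝕀 ⊗ G)) ⊗ 𝕀) = (Z^{(1,2)} ⨾ (𝕀 ⊗ G)) ⨾ Z^{(1,2)}`. [cite: JeandelPerdrixVilmart2018, Fig. 1 (S1)] -/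
theorem split_seq_gadget_par (G : ZXClass 1 0) :
    mk (Z 1 2 0) ⨟ ((mk (Z 1 2 0) ⨟ (mk (wires 1) ⊠ G)) ⊠ mk (wires 1)) = (mk (Z 1 2 0) ⨟ (mk (wires 1) ⊠ G)) ⨟ mk (Z 1 2 0) := by
  rw [seq_par_wires, ← seq_assoc, Z_seq_Z_par 1 1 1 2 le_rfl, add_zero (0 : ZMod 8), seq_assoc,
    show (mk (wires 1) ⊠ G) ⨟ mk (Z 1 2 0) = mk (Z 1 2 0) ⊠ G from by rw [par_eq_seq_right (mk (Z 1 2 0)) G, par_empty],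
    par_eq_seq_left (mk (Z 1 2 0)) G, ← seq_assoc, Z_seq_Z_par 1 1 1 2 le_rfl, add_zero (0 : ZMod 8),
    show mk (wires 2) ⊠ G = (mk (wires 1) ⊠ mk swap) ⨟ ((mk (wires 1) ⊠ G) ⊠ mk (wires 1)) from by
      rw [show (mk (wires 1) ⊠ G) ⊠ mk (wires 1) = mk (wires 1) ⊠ (G ⊠ mk (wires 1)) from (par_assoc _ _ _).trans (cast_id _ _ _),
        ← wires_par_seq, swap_seq_effect_par, ← wires_par_wires 1 1]
      exact (par_assoc _ _ _).trans (cast_id _ _ _),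
    ← seq_assoc, Z_one_three_seq_par_swap]

/-- **Appendix Lemma 29** (`looped-triangle`): `√2 ⊗ (Z^{(1,2)} ⨾ (T ⊗ 𝕀) ⨾ X^{(2,1)}) = T`
(the green node of `T` commutes with the copy; the remaining green–red `4`-cycle contracts by (B2)).
[cite: JeandelPerdrixVilmart2018, Appendix Lemma 29] -/
theorem looped_triangle : mk (dumbbell 0 0) ⊠ (mk (Z 1 2 0) ⨟ (mk triangle ⊠ mk (wires 1)) ⨟ mk (X 2 1 0)) = mk triangle := by
  have hx2 : (mk (X 1 1 2) ⊠ mk (wires 1)) ⨟ mk (X 2 1 0) = mk (X 2 1 0) ⨟ mk (X 1 1 2) := by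
    rw [X_par_seq_X 1 1 1 1 le_rfl, X_seq_X 2 1 1 le_rfl, zero_add, add_zero]
  have hL : mk (xLeafL 0 1) ⨟ mk (Z 1 1 1) = mk (X 1 2 0) ⨟ (mk (Z 1 0 1) ⊠ mk (wires 1)) ⨟ mk (Z 1 1 1) := by
    simp only [xLeafL, mk_seq, mk_par]
  have hZ1 : mk (Z 1 2 0) ⨟ (mk (Z 1 0 1) ⊠ mk (wires 1)) = mk (Z 1 1 1) := by
    rw [Z_seq_Z_par 1 1 1 0 le_rfl, add_zero (1 : ZMod 8)]
  rw [mk_triangle, seq_par_wires, seq_par_wires, seq_par_wires, ← seq_assoc (mk (Z 1 2 0)) _ (mk (X 1 1 2) ⊠ mk (wires 1)),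
    seq_assoc _ (mk (X 1 1 2) ⊠ mk (wires 1)) (mk (X 2 1 0)), hx2, ← seq_assoc _ (mk (X 2 1 0)) (mk (X 1 1 2)),
    ← seq_assoc (mk (Z 1 2 0)) _ (mk (Z 1 1 1) ⊠ mk (wires 1)), ← seq_assoc (mk (Z 1 2 0)) _ (mk (xLeafL 0 1) ⊠ mk (wires 1)),
    split_seq_gadget_par, seq_assoc _ (mk (xLeafL 0 1) ⊠ mk (wires 1)) (mk (Z 1 1 1) ⊠ mk (wires 1)), ← seq_par_wires,
    seq_assoc (mk (Z 1 2 0) ⨟ (mk (wires 1) ⊠ (mk (X 1 2 0) ⨟ (mk (Z 1 0 (-1)) ⊠ mk (Z 1 0 (-1)))))) (mk (Z 1 2 0)),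
    seq_assoc (mk (Z 1 2 0) ⨟ (mk (wires 1) ⊠ (mk (X 1 2 0) ⨟ (mk (Z 1 0 (-1)) ⊠ mk (Z 1 0 (-1)))))) _ (mk (X 2 1 0)),
    ← scalar_par_seq_one, ← seq_scalar_par_one, hL, four_cycle, seq_assoc (mk (xLeafL 0 1)), hZ1, ← seq_assoc]

/-- **Appendix Lemma 29, transposed**: `√2 ⊗ (X^{(1,2)} ⨾ (Tᵗ ⊗ 𝕀) ⨾ Z^{(2,1)}) = Tᵗ`. [cite: JeandelPerdrixVilmart2018, Appendix Lemma 29] -/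
theorem looped_triangle_transpose :
    mk (dumbbell 0 0) ⊠ (mk (X 1 2 0) ⨟ ((mk triangle).transpose ⊠ mk (wires 1)) ⨟ mk (Z 2 1 0)) = (mk triangle).transpose := by
  have h := congrArg transpose looped_triangle
  rw [transpose_par, transpose_mk (dumbbell 0 0), mk_transpose_dumbbell, transpose_seq, transpose_seq, transpose_par, transpose_mk (X 2 1 0),
    transpose_mk (Z 1 2 0), transpose_mk (wires 1), ZXDiagram.transpose_X, ZXDiagram.transpose_Z, ZXDiagram.transpose_wires, ← seq_assoc] at h
  exact h

/-- `Z^{(2,1)} ⨾ X(π) = (X(π) ⊗ X(π)) ⨾ Z^{(2,1)}` ((K1) transposed). [cite: JeandelPerdrixVilmart2018, Fig. 1 (K1)] -/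
theorem Z_merge_seq_X_pi : mk (Z 2 1 0) ⨟ mk (X 1 1 4) = (mk (X 1 1 4) ⊠ mk (X 1 1 4)) ⨟ mk (Z 2 1 0) := by
  have h := congrArg transpose K1_red
  simpa using h

/-- A red `π` on one input of the green merge moves to the other input and the output. [cite: JeandelPerdrixVilmart2018, Fig. 1 (K1)] -/
theorem X_pi_par_seq_Z_merge : (mk (X 1 1 4) ⊠ mk (wires 1)) ⨟ mk (Z 2 1 0) = (mk (wires 1) ⊠ mk (X 1 1 4)) ⨟ mk (Z 2 1 0) ⨟ mk (X 1 1 4) := by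
  rw [seq_assoc, Z_merge_seq_X_pi, ← seq_assoc, interchange, id_seq, xphase_seq_xphase, show (4 : ZMod 8) + 4 = 0 from by decide, X_one_one]

/-- **Appendix Lemma 29, red version**: `√2 ⊗ (X^{(1,2)} ⨾ (T ⊗ 𝕀) ⨾ Z^{(2,1)}) = X(π) ⨾ T`, i.e.
`√2 ⊗ (X^{(1,2)}(π) ⨾ (T ⊗ 𝕀) ⨾ Z^{(2,1)}) = T`. [cite: JeandelPerdrixVilmart2018, Appendix Lemma 29] -/
theorem xlooped_triangle : mk (dumbbell 0 0) ⊠ (mk (X 1 2 0) ⨟ (mk triangle ⊠ mk (wires 1)) ⨟ mk (Z 2 1 0)) = mk (X 1 1 4) ⨟ mk triangle := by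
  have h := looped_triangle_transpose
  have hsplit : mk (X 1 2 0) ⨟ (mk (X 1 1 4) ⊠ mk (wires 1)) = mk (X 1 2 4) := by
    have h := congrArg colorSwap (Z_seq_Z_par 1 1 1 1 le_rfl 4 0)
    simp only [colorSwap_seq, colorSwap_par, colorSwap_mk, ZXDiagram.colorSwap_Z, ZXDiagram.colorSwap_wires] at h
    rw [add_zero] at h
    exact h
  rw [triangle_transpose_eq, seq_par_wires, seq_par_wires, seq_assoc (mk (X 1 2 0)) _ (mk (Z 2 1 0)),
    seq_assoc _ (mk (X 1 1 4) ⊠ mk (wires 1)) (mk (Z 2 1 0)), X_pi_par_seq_Z_merge, seq_assoc (mk (wires 1) ⊠ mk (X 1 1 4)) (mk (Z 2 1 0)) (mk (X 1 1 4)),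
    ← seq_assoc _ (mk (wires 1) ⊠ mk (X 1 1 4)) (mk (Z 2 1 0) ⨟ mk (X 1 1 4)), seq_assoc (mk (X 1 1 4) ⊠ mk (wires 1)) (mk triangle ⊠ mk (wires 1)) (mk (wires 1) ⊠ mk (X 1 1 4)),
    ← par_eq_seq_left, par_eq_seq_right (mk triangle) (mk (X 1 1 4)), ← seq_assoc (mk (X 1 1 4) ⊠ mk (wires 1)) (mk (wires 1) ⊠ mk (X 1 1 4)) (mk triangle ⊠ mk (wires 1)),
    ← par_eq_seq_left, ← seq_assoc (mk (X 1 2 0)), ← seq_assoc (mk (X 1 2 0)) (mk (X 1 1 4) ⊠ mk (X 1 1 4)) (mk triangle ⊠ mk (wires 1)),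
    par_eq_seq_left (mk (X 1 1 4)) (mk (X 1 1 4)), ← seq_assoc (mk (X 1 2 0)), hsplit, X_seq_par_X 1 1 1 1 le_rfl,
    show (4 : ZMod 8) + 4 = 0 from by decide, ← seq_assoc _ (mk (Z 2 1 0)) (mk (X 1 1 4)), ← scalar_par_seq_one] at h
  -- cancel the trailing `X(π)`
  have h' := congrArg (· ⨟ mk (X 1 1 4)) h
  simp only [seq_assoc, xphase_seq_xphase, show (4 : ZMod 8) + 4 = 0 from by decide, X_one_one, seq_id] at h'
  rw [← seq_assoc] at h'
  exact h'

/-- **Appendix Lemma 29, red version with the `π`**: `√2 ⊗ (X^{(1,2)}(π) ⨾ (T ⊗ 𝕀) ⨾ Z^{(2,1)}) = T`.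
[cite: JeandelPerdrixVilmart2018, Appendix Lemma 29] -/
theorem xlooped_triangle_pi : mk (dumbbell 0 0) ⊠ (mk (X 1 2 4) ⨟ (mk triangle ⊠ mk (wires 1)) ⨟ mk (Z 2 1 0)) = mk triangle := by
  have h := congrArg (mk (X 1 1 4) ⨟ ·) xlooped_triangle
  rwa [seq_scalar_par_one, ← seq_assoc, ← seq_assoc, X_seq_X 1 1 2 le_rfl, add_zero (4 : ZMod 8), ← seq_assoc (mk (X 1 1 4)) (mk (X 1 1 4)),
    xphase_seq_xphase, show (4 : ZMod 8) + 4 = 0 from by decide, X_one_one, id_seq] at h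

/-! ### Appendix Lemma 32: the inverse of the triangle -/

/-- **A green node with a two-leaf gadget is its own transpose** (leaf phase `d`):
`(𝕀 ⊗ ((Z^{(0,1)}(d))^{⊗2} ⨾ X^{(2,1)})) ⨾ Z^{(2,1)} = Z^{(1,2)} ⨾ (𝕀 ⊗ (X^{(1,2)} ⨾ (Z^{(1,0)}(d))^{⊗2}))`.
[cite: JeandelPerdrixVilmart2018, §2.2] -/
theorem par_gadget_transpose_seq_merge (d : ZMod 8) :
    (mk (wires 1) ⊠ ((mk (Z 0 1 d) ⊠ mk (Z 0 1 d)) ⨟ mk (X 2 1 0))) ⨟ mk (Z 2 1 0) =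
      mk (Z 1 2 0) ⨟ (mk (wires 1) ⊠ (mk (X 1 2 0) ⨟ (mk (Z 1 0 d) ⊠ mk (Z 1 0 d)))) := by
  have hG : mk (X 1 2 0) ⨟ (mk (Z 1 0 d) ⊠ mk (Z 1 0 d)) = mk (xLeafL 0 d) ⨟ mk (Z 1 0 d) := by
    simp only [xLeafL, mk_seq, mk_par]
    rw [par_eq_seq_left (mk (Z 1 0 d)) (mk (Z 1 0 d)), ← seq_assoc, empty_par, cast_id]
  rw [hG, ← par_cup_seq_merge_par, seq_assoc, show (mk (Z 2 1 0) ⊠ mk (wires 1)) ⨟ (mk (wires 1) ⊠ (mk (xLeafL 0 d) ⨟ mk (Z 1 0 d))) =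
      (mk (wires 2) ⊠ (mk (xLeafL 0 d) ⨟ mk (Z 1 0 d))) ⨟ mk (Z 2 1 0) from by rw [slide, par_empty],
    ← seq_assoc, ← wires_par_wires 1 1, show (mk (wires 1) ⊠ mk (wires 1)) ⊠ (mk (xLeafL 0 d) ⨟ mk (Z 1 0 d)) =
      mk (wires 1) ⊠ (mk (wires 1) ⊠ (mk (xLeafL 0 d) ⨟ mk (Z 1 0 d))) from (par_assoc _ _ _).trans (cast_id _ _ _),
    ← wires_par_seq, cup_seq_par_leaf_effect, ← Z_states_seq_X_merge]

/-- The green node of the triangle with its gadget is its own transpose. [cite: JeandelPerdrixVilmart2018, §2.2] -/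
theorem gadgetNode_transpose :
    (mk (Z 1 2 0) ⨟ (mk (wires 1) ⊠ (mk (X 1 2 0) ⨟ (mk (Z 1 0 (-1)) ⊠ mk (Z 1 0 (-1)))))).transpose =
      mk (Z 1 2 0) ⨟ (mk (wires 1) ⊠ (mk (X 1 2 0) ⨟ (mk (Z 1 0 (-1)) ⊠ mk (Z 1 0 (-1))))) := by
  rw [transpose_seq, transpose_par, transpose_seq, transpose_par, transpose_mk (Z 1 2 0), transpose_mk (wires 1), transpose_mk (X 1 2 0),
    transpose_mk (Z 1 0 (-1)), ZXDiagram.transpose_Z, ZXDiagram.transpose_Z, ZXDiagram.transpose_X, ZXDiagram.transpose_wires,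
    par_gadget_transpose_seq_merge]

/-- **The transposed triangle, explicitly**: `Tᵗ = X(π/2) ⨾ Z(π/4) ⨾ xLeafL 0 (π/4) ⨾ (Z^{(1,2)} ⨾ (𝕀 ⊗ gadget))`.
[cite: JeandelPerdrixVilmart2018, §6] -/
theorem triangle_transpose_explicit : (mk triangle).transpose =
    mk (X 1 1 2) ⨟ mk (Z 1 1 1) ⨟ mk (xLeafL 0 1) ⨟ (mk (Z 1 2 0) ⨟ (mk (wires 1) ⊠ (mk (X 1 2 0) ⨟ (mk (Z 1 0 (-1)) ⊠ mk (Z 1 0 (-1)))))) := by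
  rw [mk_triangle, transpose_seq, transpose_seq, transpose_seq, gadgetNode_transpose, xLeafL_transpose, transpose_mk (Z 1 1 1), transpose_mk (X 1 1 2),
    ZXDiagram.transpose_Z, ZXDiagram.transpose_X, ← seq_assoc, ← seq_assoc]

/-- `T = X(π) ⨾ Tᵗ ⨾ X(π)`. [cite: JeandelPerdrixVilmart2018, Appendix Lemma 21] -/
theorem triangle_eq_conj_transpose : mk triangle = mk (X 1 1 4) ⨟ (mk triangle).transpose ⨟ mk (X 1 1 4) := by
  rw [triangle_transpose_eq, ← seq_assoc, ← seq_assoc, xphase_seq_xphase, show (4 : ZMod 8) + 4 = 0 from by decide, X_one_one, id_seq, seq_assoc,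
    xphase_seq_xphase, show (4 : ZMod 8) + 4 = 0 from by decide, X_one_one, seq_id]

/-- **The red `π` pushed through the green node flips the gadget's red phase**:
`(Z^{(1,2)} ⨾ (𝕀 ⊗ (X^{(1,2)} ⨾ E))) ⨾ X(π) = X(π) ⨾ Z^{(1,2)} ⨾ (𝕀 ⊗ (X^{(1,2)}(π) ⨾ E))`. [cite: JeandelPerdrixVilmart2018, Fig. 1 (K1)] -/
theorem gadgetNode_seq_X_pi (E : ZXClass 2 0) :
    (mk (Z 1 2 0) ⨟ (mk (wires 1) ⊠ (mk (X 1 2 0) ⨟ E))) ⨟ mk (X 1 1 4) = mk (X 1 1 4) ⨟ (mk (Z 1 2 0) ⨟ (mk (wires 1) ⊠ (mk (X 1 2 4) ⨟ E))) := by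
  rw [seq_assoc, show (mk (wires 1) ⊠ (mk (X 1 2 0) ⨟ E)) ⨟ mk (X 1 1 4) = (mk (X 1 1 4) ⊠ mk (wires 1)) ⨟ (mk (wires 1) ⊠ (mk (X 1 2 0) ⨟ E)) from by
      rw [← par_eq_seq_left, par_eq_seq_right (mk (X 1 1 4)) (mk (X 1 2 0) ⨟ E), par_empty],
    ← seq_assoc, show mk (Z 1 2 0) ⨟ (mk (X 1 1 4) ⊠ mk (wires 1)) = mk (X 1 1 4) ⨟ mk (Z 1 2 0) ⨟ (mk (wires 1) ⊠ mk (X 1 1 4)) from by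
      rw [K1_red, seq_assoc, par_eq_seq_left (mk (X 1 1 4)) (mk (X 1 1 4)), seq_assoc, ← wires_par_seq, xphase_seq_xphase,
        show (4 : ZMod 8) + 4 = 0 from by decide, X_one_one, wires_par_wires, seq_id],
    seq_assoc, seq_assoc, ← wires_par_seq, ← seq_assoc (mk (X 1 1 4)) (mk (X 1 2 0)) E, X_seq_X 1 1 2 le_rfl, add_zero]

/-- **The two gadgets of a triangle and an upside-down triangle cancel** (Appendix Lemma 19 transposed):
`Z^{(1,2)} ⨾ ((X^{(1,2)} ⨾ (Z^{(1,0)}(-π/4))^{⊗2}) ⊗ (X^{(1,2)}(π) ⨾ (Z^{(1,0)}(-π/4))^{⊗2})) = db 4 (-2) ⊗ Z^{(1,0)}`.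
[cite: JeandelPerdrixVilmart2018, Appendix Lemma 19] -/
theorem split_seq_gadgets :
    mk (Z 1 2 0) ⨟ ((mk (X 1 2 0) ⨟ (mk (Z 1 0 (-1)) ⊠ mk (Z 1 0 (-1)))) ⊠ (mk (X 1 2 4) ⨟ (mk (Z 1 0 (-1)) ⊠ mk (Z 1 0 (-1))))) =
      mk (dumbbell 4 (-2)) ⊠ mk (Z 1 0 0) := by
  have h := congrArg transpose supp_to_minus_pi_4
  simpa [mk_transpose_dumbbell] using h

/-- **The flipped-gadget node followed by the gadget node is `db 4 (-2) ⊗ 𝕀`**. [cite: JeandelPerdrixVilmart2018, Appendix Lemma 32 (proof)] -/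
theorem gadgetNode_pi_seq_gadgetNode :
    (mk (Z 1 2 0) ⨟ (mk (wires 1) ⊠ (mk (X 1 2 4) ⨟ (mk (Z 1 0 (-1)) ⊠ mk (Z 1 0 (-1)))))) ⨟
        (mk (Z 1 2 0) ⨟ (mk (wires 1) ⊠ (mk (X 1 2 0) ⨟ (mk (Z 1 0 (-1)) ⊠ mk (Z 1 0 (-1)))))) = mk (dumbbell 4 (-2)) ⊠ mk (wires 1) := by
  set G := mk (X 1 2 0) ⨟ (mk (Z 1 0 (-1)) ⊠ mk (Z 1 0 (-1))) with hGdef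
  set Gp := mk (X 1 2 4) ⨟ (mk (Z 1 0 (-1)) ⊠ mk (Z 1 0 (-1))) with hGpdef
  rw [seq_assoc, ← seq_assoc (mk (wires 1) ⊠ Gp) (mk (Z 1 2 0)), show (mk (wires 1) ⊠ Gp) ⨟ mk (Z 1 2 0) = mk (Z 1 2 0) ⊠ Gp from by
      rw [par_eq_seq_right (mk (Z 1 2 0)) Gp, par_empty],
    par_eq_seq_left (mk (Z 1 2 0)) Gp, seq_assoc, ← seq_assoc (mk (Z 1 2 0)) (mk (Z 1 2 0) ⊠ mk (wires 1)), Z_seq_Z_par 1 1 1 2 le_rfl, add_zero (0 : ZMod 8),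
    show (mk (wires 2) ⊠ Gp) ⨟ (mk (wires 1) ⊠ G) = mk (wires 1) ⊠ (G ⊠ Gp) from by
      rw [← wires_par_wires 1 1, show (mk (wires 1) ⊠ mk (wires 1)) ⊠ Gp = mk (wires 1) ⊠ (mk (wires 1) ⊠ Gp) from (par_assoc _ _ _).trans (cast_id _ _ _),
        ← wires_par_seq, show (mk (wires 1) ⊠ Gp) ⨟ G = G ⊠ Gp from by rw [par_eq_seq_right G Gp, par_empty]],
    show mk (Z 1 3 0) = mk (Z 1 2 0) ⨟ (mk (wires 1) ⊠ mk (Z 1 2 0)) from by rw [Z_seq_par_Z 1 1 1 2 le_rfl, add_zero (0 : ZMod 8)],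
    seq_assoc, ← wires_par_seq, hGdef, hGpdef, split_seq_gadgets, Z_split_seq_par_scalar_par, Z_seq_par_Z 1 1 1 0 le_rfl, add_zero (0 : ZMod 8), Z_one_one]

/-- `xLeafL 0 c ⨾ X(π) = xLeafL π c`. [cite: JeandelPerdrixVilmart2018, Fig. 1 (S1)] -/
theorem xLeafL_zero_seq_X_pi (c : ZMod 8) : mk (xLeafL 0 c) ⨟ mk (X 1 1 4) = mk (xLeafL 4 c) := by
  rw [← xLeafL_pi_seq_X_pi c, seq_assoc, xphase_seq_xphase, show (4 : ZMod 8) + 4 = 0 from by decide, X_one_one, seq_id]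

/-- **(K), colour-swapped**: `√2 ⊗ (Z(α) ⨾ X(π)) = db 4 α ⊗ (X(π) ⨾ Z(-α))`. [cite: JeandelPerdrixVilmart2018, Fig. 1 (K)] -/
theorem sqrt_two_par_Z_phase_seq_X_pi (a : ZMod 8) :
    mk (dumbbell 0 0) ⊠ (mk (Z 1 1 a) ⨟ mk (X 1 1 4)) = mk (dumbbell 4 a) ⊠ (mk (X 1 1 4) ⨟ mk (Z 1 1 (-a))) := by
  have h := congrArg colorSwap (rule_K a)
  simpa using h

/-- `√2 ⊗ (X(π/2) ⨾ Z(π) ⨾ X(π/2)) = db 2 4 ⊗ Z(π)` ((K)). [cite: JeandelPerdrixVilmart2018, Fig. 1 (K)] -/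
theorem sqrt_two_par_X_two_seq_Z_pi_seq_X_two :
    mk (dumbbell 0 0) ⊠ (mk (X 1 1 2) ⨟ mk (Z 1 1 4) ⨟ mk (X 1 1 2)) = mk (dumbbell 2 4) ⊠ mk (Z 1 1 4) := by
  rw [← scalar_par_seq_one, rule_K, scalar_par_seq_one, seq_assoc, xphase_seq_xphase, neg_add_cancel, X_one_one, seq_id]

/-- The gadget node through `Z(π)`: `Z(π)` commutes with it. [cite: JeandelPerdrixVilmart2018, Fig. 1 (S1)] -/
theorem gadgetNode_seq_Z_pi (E : ZXClass 1 0) :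
    (mk (Z 1 2 0) ⨟ (mk (wires 1) ⊠ E)) ⨟ mk (Z 1 1 4) = mk (Z 1 1 4) ⨟ (mk (Z 1 2 0) ⨟ (mk (wires 1) ⊠ E)) := by
  rw [seq_assoc, show (mk (wires 1) ⊠ E) ⨟ mk (Z 1 1 4) = (mk (Z 1 1 4) ⊠ mk (wires 1)) ⨟ (mk (wires 1) ⊠ E) from by
      rw [← par_eq_seq_left, par_eq_seq_right (mk (Z 1 1 4)) E, par_empty],
    ← seq_assoc, Z_seq_Z_par 1 1 1 1 le_rfl, ← seq_assoc, Z_seq_Z 1 1 2 le_rfl, add_zero]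

/-- **The gadget pair on the spine**: `Gn ⨾ X(π) ⨾ Z(π) ⨾ Gn ⨾ R = db 4 (-2) ⊗ (X(π) ⨾ Z(π) ⨾ R)`.
[cite: JeandelPerdrixVilmart2018, Appendix Lemma 32 (proof)] -/
theorem gadget_pair_cont (R : ZXClass 1 1) :
    mk (Z 1 2 0) ⨟ ((mk (wires 1) ⊠ (mk (X 1 2 0) ⨟ (mk (Z 1 0 (-1)) ⊠ mk (Z 1 0 (-1))))) ⨟ (mk (X 1 1 4) ⨟ (mk (Z 1 1 4) ⨟
      (mk (Z 1 2 0) ⨟ ((mk (wires 1) ⊠ (mk (X 1 2 0) ⨟ (mk (Z 1 0 (-1)) ⊠ mk (Z 1 0 (-1))))) ⨟ R))))) =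
      mk (dumbbell 4 (-2)) ⊠ (mk (X 1 1 4) ⨟ (mk (Z 1 1 4) ⨟ R)) := by
  have hblock : (mk (Z 1 2 0) ⨟ (mk (wires 1) ⊠ (mk (X 1 2 0) ⨟ (mk (Z 1 0 (-1)) ⊠ mk (Z 1 0 (-1)))))) ⨟ mk (X 1 1 4) ⨟ mk (Z 1 1 4) ⨟
      (mk (Z 1 2 0) ⨟ (mk (wires 1) ⊠ (mk (X 1 2 0) ⨟ (mk (Z 1 0 (-1)) ⊠ mk (Z 1 0 (-1)))))) = mk (dumbbell 4 (-2)) ⊠ (mk (X 1 1 4) ⨟ mk (Z 1 1 4)) := by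
    rw [gadgetNode_seq_X_pi, seq_assoc (mk (X 1 1 4)), gadgetNode_seq_Z_pi, seq_assoc (mk (X 1 1 4)), seq_assoc (mk (Z 1 1 4)),
      gadgetNode_pi_seq_gadgetNode, seq_scalar_par_one, seq_id, seq_scalar_par_one]
  have h := congrArg (· ⨟ R) hblock
  simp only [seq_assoc] at h
  rw [h, scalar_par_seq_one, seq_assoc]

/-- **The leaf pair on the spine**: `xLeafL 0 (π/4) ⨾ X(π) ⨾ Z(π) ⨾ xLeafL 0 (π/4) ⨾ R = (1/√2 ⊗ 1/√2 ⊗ db 4 (-1)) ⊗ (X(π) ⨾ Z(π) ⨾ R)`.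
[cite: JeandelPerdrixVilmart2018, Appendix Lemma 32 (proof)] -/
theorem leaf_pair_cont (R : ZXClass 1 1) :
    mk (xLeafL 0 1) ⨟ (mk (X 1 1 4) ⨟ (mk (Z 1 1 4) ⨟ (mk (xLeafL 0 1) ⨟ R))) =
      (mk invSqrtTwo ⊠ (mk invSqrtTwo ⊠ mk (dumbbell 4 (-1)))) ⊠ (mk (X 1 1 4) ⨟ (mk (Z 1 1 4) ⨟ R)) := by
  have hblock : mk (xLeafL 0 1) ⨟ mk (X 1 1 4) ⨟ mk (Z 1 1 4) ⨟ mk (xLeafL 0 1) = (mk invSqrtTwo ⊠ (mk invSqrtTwo ⊠ mk (dumbbell 4 (-1)))) ⊠ (mk (X 1 1 4) ⨟ mk (Z 1 1 4)) := by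
    rw [xLeafL_zero_seq_X_pi, seq_assoc, Z_pi_seq_xLeafL, show (1 : ZMod 8) + 4 = 5 from by decide, ← seq_assoc, ← X_pi_seq_xLeafL 1, seq_assoc (mk (X 1 1 4)),
      xLeafL_one_seq_xLeafL_five, seq_scalar_par_one, seq_id, scalar_par_seq_one]
  have h := congrArg (· ⨟ R) hblock
  simp only [seq_assoc] at h
  rw [h, scalar_par_seq_one, seq_assoc]

/-- `1/√2 ⊗ √2` in front of a `1 → 1` map. [cite: JeandelPerdrixVilmart2018, Appendix Lemma 5] -/
theorem invSqrtTwo_par_sqrt_two_par_one (A : ZXClass 1 1) : mk invSqrtTwo ⊠ (mk (dumbbell 0 0) ⊠ A) = A := by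
  rw [show mk invSqrtTwo ⊠ (mk (dumbbell 0 0) ⊠ A) = (mk invSqrtTwo ⊠ mk (dumbbell 0 0)) ⊠ A from (par_assoc' _ _ _).trans (cast_id _ _ _),
    invSqrtTwo_par_dumbbell, empty_par, cast_id]

/-- **`T ⨾ Z(π) ⨾ T = Z(π)`** (the heart of Appendix Lemma 32). [cite: JeandelPerdrixVilmart2018, Appendix Lemma 32] -/
theorem triangle_seq_Z_pi_seq_triangle : mk triangle ⨟ mk (Z 1 1 4) ⨟ mk triangle = mk (Z 1 1 4) := by
  have hT := triangle_eq_conj_transpose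
  rw [triangle_transpose_explicit] at hT
  refine cancel_sqrt_two_left (cancel_sqrt_two_left ?_)
  nth_rewrite 1 [hT]
  rw [mk_triangle]
  simp only [seq_assoc]
  rw [gadget_pair_cont, seq_scalar_par_one, seq_scalar_par_one, seq_scalar_par_one, seq_scalar_par_one, leaf_pair_cont,
    seq_scalar_par_one, seq_scalar_par_one, seq_scalar_par_one,
    -- reorder the scalars: `db 4 (-2) ⊗ c₅ ⊗ √2 ⊗ √2 ⊗ spine`
    scalar_par_scalar_par (mk (dumbbell 0 0)) (mk (dumbbell 4 (-2))), scalar_par_scalar_par (mk (dumbbell 0 0)) (mk (dumbbell 4 (-2))),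
    scalar_par_scalar_par (mk (dumbbell 0 0)) (mk invSqrtTwo ⊠ (mk invSqrtTwo ⊠ mk (dumbbell 4 (-1)))),
    scalar_par_scalar_par (mk (dumbbell 0 0)) (mk invSqrtTwo ⊠ (mk invSqrtTwo ⊠ mk (dumbbell 4 (-1)))),
    -- (K) on `Z(π/4) ⨾ X(π)` with the first `√2`
    ← seq_scalar_par_one (mk (dumbbell 0 0)) (mk (X 1 1 4)), ← seq_scalar_par_one (mk (dumbbell 0 0)) (mk (X 1 1 2)),
    ← seq_assoc (mk (Z 1 1 1)) (mk (X 1 1 4)), ← scalar_par_seq_one (mk (dumbbell 0 0)) (mk (Z 1 1 1) ⨟ mk (X 1 1 4)),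
    sqrt_two_par_Z_phase_seq_X_pi, scalar_par_seq_one, seq_assoc (mk (X 1 1 4)) (mk (Z 1 1 (-1))),
    ← seq_assoc (mk (Z 1 1 (-1))) (mk (Z 1 1 4)), phase_seq_phase, ← seq_assoc (mk (Z 1 1 (-1 + 4))) (mk (Z 1 1 1)), phase_seq_phase,
    show (-1 : ZMod 8) + 4 + 1 = 4 from by decide, seq_scalar_par_one, seq_scalar_par_one,
    -- fuse the reds, (K) on `X(π/2) Z(π) X(π/2)` with the second `√2`
    ← seq_assoc (mk (X 1 1 4)) (mk (X 1 1 2)), xphase_seq_xphase, ← seq_assoc (mk (X 1 1 (4 + 2))) (mk (X 1 1 4)), xphase_seq_xphase,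
    show (4 : ZMod 8) + 2 + 4 = 2 from by decide, scalar_par_scalar_par (mk (dumbbell 0 0)) (mk (dumbbell 4 1)), sqrt_two_par_X_two_seq_Z_pi_seq_X_two',
    dumbbell_comm_colors 2 4,
    -- the scalars multiply to `√2 ⊗ √2`
    show ∀ Y : ZXClass 1 1, (mk invSqrtTwo ⊠ (mk invSqrtTwo ⊠ mk (dumbbell 4 (-1)))) ⊠ Y = mk invSqrtTwo ⊠ (mk invSqrtTwo ⊠ (mk (dumbbell 4 (-1)) ⊠ Y))
      from fun Y => by
        rw [show (mk invSqrtTwo ⊠ (mk invSqrtTwo ⊠ mk (dumbbell 4 (-1)))) ⊠ Y = mk invSqrtTwo ⊠ ((mk invSqrtTwo ⊠ mk (dumbbell 4 (-1))) ⊠ Y)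
            from (par_assoc _ _ _).trans (cast_id _ _ _)]
        exact congrArg (mk invSqrtTwo ⊠ ·) ((par_assoc _ _ _).trans (cast_id _ _ _)),
    show ∀ Y : ZXClass 1 1, mk (dumbbell 4 (-1)) ⊠ (mk (dumbbell 4 1) ⊠ Y) = (mk (dumbbell 4 (-1)) ⊠ mk (dumbbell 4 1)) ⊠ Y
      from fun Y => (par_assoc' _ _ _).trans (cast_id _ _ _),
    dumbbell_four_mul, neg_add_cancel, dumbbell_four_zero,
    show ∀ Y : ZXClass 1 1, (mk (dumbbell 0 0) ⊠ mk (dumbbell 0 0)) ⊠ Y = mk (dumbbell 0 0) ⊠ (mk (dumbbell 0 0) ⊠ Y)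
      from fun Y => (par_assoc _ _ _).trans (cast_id _ _ _),
    invSqrtTwo_par_sqrt_two_par_one, invSqrtTwo_par_sqrt_two_par_one,
    show ∀ Y : ZXClass 1 1, mk (dumbbell 4 (-2)) ⊠ (mk (dumbbell 4 2) ⊠ Y) = (mk (dumbbell 4 (-2)) ⊠ mk (dumbbell 4 2)) ⊠ Y
      from fun Y => (par_assoc' _ _ _).trans (cast_id _ _ _),
    dumbbell_four_mul, neg_add_cancel, dumbbell_four_zero]
  exact (par_assoc _ _ _).trans (cast_id _ _ _)
  where
  sqrt_two_par_X_two_seq_Z_pi_seq_X_two' : mk (dumbbell 0 0) ⊠ (mk (X 1 1 2) ⨟ (mk (Z 1 1 4) ⨟ mk (X 1 1 2))) = mk (dumbbell 2 4) ⊠ mk (Z 1 1 4) := by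
    rw [← seq_assoc]; exact sqrt_two_par_X_two_seq_Z_pi_seq_X_two

/-- **Appendix Lemma 32** (`inverse-of-triangle`): `T ⨾ Z(π) ⨾ T ⨾ Z(π) = 𝕀`. [cite: JeandelPerdrixVilmart2018, Appendix Lemma 32] -/
theorem inverse_of_triangle : mk triangle ⨟ mk (Z 1 1 4) ⨟ mk triangle ⨟ mk (Z 1 1 4) = mk (wires 1) := by
  rw [triangle_seq_Z_pi_seq_triangle, phase_seq_phase, show (4 : ZMod 8) + 4 = 0 from by decide, Z_one_one]

/-- **Appendix Lemma 32**, second form: `Z(π) ⨾ T ⨾ Z(π) ⨾ T = 𝕀`. [cite: JeandelPerdrixVilmart2018, Appendix Lemma 32] -/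
theorem inverse_of_triangle' : mk (Z 1 1 4) ⨟ mk triangle ⨟ mk (Z 1 1 4) ⨟ mk triangle = mk (wires 1) := by
  rw [seq_assoc (mk (Z 1 1 4)), seq_assoc (mk (Z 1 1 4)), triangle_seq_Z_pi_seq_triangle, phase_seq_phase,
    show (4 : ZMod 8) + 4 = 0 from by decide, Z_one_one]

/-! ### Appendix Lemma 28: the triangle in parallel with a Hadamard wire -/

/-- `H ⨾ Z(α) = X(α) ⨾ H`. [cite: JeandelPerdrixVilmart2018, Fig. 1 (H)] -/
theorem hBox_seq_Z_phase (a : ZMod 8) : mk hBox ⨟ mk (Z 1 1 a) = mk (X 1 1 a) ⨟ mk hBox := (X_phase_seq_hBox a).symm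

/-- A green `π` on one input of the red merge moves to the other input and the output ((K1)).
[cite: JeandelPerdrixVilmart2018, Fig. 1 (K1)] -/
theorem Z_pi_par_seq_X_merge : (mk (Z 1 1 4) ⊠ mk (wires 1)) ⨟ mk (X 2 1 0) = (mk (wires 1) ⊠ mk (Z 1 1 4)) ⨟ mk (X 2 1 0) ⨟ mk (Z 1 1 4) := by
  have h := congrArg colorSwap X_pi_par_seq_Z_merge
  simpa using h

/-- A green `π` on an output of the copy is a green `π` on its input. [cite: JeandelPerdrixVilmart2018, Fig. 1 (S1)] -/
theorem split_seq_par_Z_pi : mk (Z 1 2 0) ⨟ (mk (wires 1) ⊠ mk (Z 1 1 4)) = mk (Z 1 1 4) ⨟ mk (Z 1 2 0) := by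
  rw [Z_seq_par_Z 1 1 1 1 le_rfl, Z_seq_Z 1 1 2 le_rfl, zero_add, add_zero]

/-- **The branch of Lemma 28 by Euler**: `xLeafL 0 (π/4) ⨾ Z(π/4) ⨾ X(π/2) ⨾ H = (1/√2 ⊗ Z^{(0,0)}(-π/2)) ⊗ (xLeafL 0 (π/4) ⨾ Z(3π/4) ⨾ X(π/2) ⨾ Z(π))`.
[cite: JeandelPerdrixVilmart2018, Appendix Lemmas 16, 28] -/
theorem leafBranch_seq_hBox :
    mk (xLeafL 0 1) ⨟ mk (Z 1 1 1) ⨟ mk (X 1 1 2) ⨟ mk hBox =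
      mk invSqrtTwo ⊠ (mk (Z 0 0 (-2)) ⊠ (mk (xLeafL 0 1) ⨟ mk (Z 1 1 3) ⨟ mk (X 1 1 2) ⨟ mk (Z 1 1 4))) := by
  rw [seq_assoc _ (mk (X 1 1 2)) (mk hBox), X_phase_seq_hBox, hBox_eq_euler, scalar_par_seq_one, scalar_par_seq_one, seq_scalar_par_one,
    seq_scalar_par_one, seq_assoc _ (mk (Z 1 1 2)) (mk (Z 1 1 2)), phase_seq_phase, show (2 : ZMod 8) + 2 = 4 from by decide,
    ← seq_assoc _ (mk (Z 1 1 2) ⨟ mk (X 1 1 2)) (mk (Z 1 1 4)), ← seq_assoc _ (mk (Z 1 1 2)) (mk (X 1 1 2)),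
    seq_assoc (mk (xLeafL 0 1)) (mk (Z 1 1 1)) (mk (Z 1 1 2)), phase_seq_phase, show (1 : ZMod 8) + 2 = 3 from by decide]

/-- **The looped branch of Lemma 28**: `√2 ⊗ (Z^{(1,2)} ⨾ ((xLeafL 0 (π/4) ⨾ Z(π/4) ⨾ X(π/2) ⨾ H) ⊗ 𝕀) ⨾ X^{(2,1)})
= (1/√2 ⊗ Z^{(0,0)}(-π/2)) ⊗ (Z(π) ⨾ xLeafL 0 (3π/4) ⨾ Z(π/4) ⨾ X(π/2) ⨾ Z(π))` (Euler, (K1), the `4`-cycle).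
[cite: JeandelPerdrixVilmart2018, Appendix Lemma 28 (proof)] -/
theorem looped_leafBranch_hBox :
    mk (dumbbell 0 0) ⊠ (mk (Z 1 2 0) ⨟ ((mk (xLeafL 0 1) ⨟ mk (Z 1 1 1) ⨟ mk (X 1 1 2) ⨟ mk hBox) ⊠ mk (wires 1)) ⨟ mk (X 2 1 0)) =
      mk invSqrtTwo ⊠ (mk (Z 0 0 (-2)) ⊠ (mk (Z 1 1 4) ⨟ mk (xLeafL 0 3) ⨟ mk (Z 1 1 1) ⨟ mk (X 1 1 2) ⨟ mk (Z 1 1 4))) := by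
  have hx2 : (mk (X 1 1 2) ⊠ mk (wires 1)) ⨟ mk (X 2 1 0) = mk (X 2 1 0) ⨟ mk (X 1 1 2) := by
    rw [X_par_seq_X 1 1 1 1 le_rfl, X_seq_X 2 1 1 le_rfl, zero_add, add_zero]
  have hL : mk (xLeafL 0 1) ⨟ mk (Z 1 1 3) = mk (X 1 2 0) ⨟ (mk (Z 1 0 1) ⊠ mk (wires 1)) ⨟ mk (Z 1 1 3) := by
    simp only [xLeafL, mk_seq, mk_par]
  have hZ1 : mk (Z 1 2 0) ⨟ (mk (Z 1 0 1) ⊠ mk (wires 1)) = mk (Z 1 1 1) := by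
    rw [Z_seq_Z_par 1 1 1 0 le_rfl, add_zero (1 : ZMod 8)]
  rw [leafBranch_seq_hBox, show ∀ (s t : ZXClass 0 0) (B : ZXClass 1 1), (s ⊠ (t ⊠ B)) ⊠ mk (wires 1) = s ⊠ (t ⊠ (B ⊠ mk (wires 1))) from fun s t B => by
      rw [show (s ⊠ (t ⊠ B)) ⊠ mk (wires 1) = s ⊠ ((t ⊠ B) ⊠ mk (wires 1)) from (par_assoc _ _ _).trans (cast_id _ _ _)]
      exact congrArg (s ⊠ ·) ((par_assoc _ _ _).trans (cast_id _ _ _)),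
    one_two_seq_scalar_par_two, one_two_seq_scalar_par_two, scalar_par_one_two_seq_one, scalar_par_one_two_seq_one,
    scalar_par_scalar_par (mk (dumbbell 0 0)) (mk invSqrtTwo), scalar_par_scalar_par (mk (dumbbell 0 0)) (mk (Z 0 0 (-2))),
    -- the green `π` goes through the red merge to the front
    seq_par_wires, seq_assoc (mk (Z 1 2 0)), seq_assoc _ (mk (Z 1 1 4) ⊠ mk (wires 1)) (mk (X 2 1 0)), Z_pi_par_seq_X_merge,
    ← seq_assoc _ ((mk (wires 1) ⊠ mk (Z 1 1 4)) ⨟ mk (X 2 1 0)) (mk (Z 1 1 4)), ← seq_assoc _ (mk (wires 1) ⊠ mk (Z 1 1 4)) (mk (X 2 1 0)),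
    show ((mk (xLeafL 0 1) ⨟ mk (Z 1 1 3) ⨟ mk (X 1 1 2)) ⊠ mk (wires 1)) ⨟ (mk (wires 1) ⊠ mk (Z 1 1 4)) =
        (mk (wires 1) ⊠ mk (Z 1 1 4)) ⨟ ((mk (xLeafL 0 1) ⨟ mk (Z 1 1 3) ⨟ mk (X 1 1 2)) ⊠ mk (wires 1)) from by rw [← par_eq_seq_left, ← par_eq_seq_right],
    ← seq_assoc (mk (Z 1 2 0)), ← seq_assoc (mk (Z 1 2 0)), ← seq_assoc (mk (Z 1 2 0)), split_seq_par_Z_pi,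
    -- the red `π/2` goes through the red merge to the back; the `4`-cycle contracts
    seq_par_wires, seq_assoc (mk (Z 1 1 4) ⨟ mk (Z 1 2 0)), seq_assoc ((mk (xLeafL 0 1) ⨟ mk (Z 1 1 3)) ⊠ mk (wires 1)), hx2,
    ← seq_assoc ((mk (xLeafL 0 1) ⨟ mk (Z 1 1 3)) ⊠ mk (wires 1)) (mk (X 2 1 0)) (mk (X 1 1 2)),
    ← seq_assoc (mk (Z 1 1 4) ⨟ mk (Z 1 2 0)) _ (mk (X 1 1 2)), seq_assoc (mk (Z 1 1 4)) (mk (Z 1 2 0)) (((mk (xLeafL 0 1) ⨟ mk (Z 1 1 3)) ⊠ mk (wires 1)) ⨟ mk (X 2 1 0)),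
    ← seq_assoc (mk (Z 1 2 0)) ((mk (xLeafL 0 1) ⨟ mk (Z 1 1 3)) ⊠ mk (wires 1)) (mk (X 2 1 0)),
    ← scalar_par_seq_one (mk (dumbbell 0 0)), ← scalar_par_seq_one (mk (dumbbell 0 0)), ← seq_scalar_par_one (mk (dumbbell 0 0)) (mk (Z 1 1 4)),
    hL, four_cycle, seq_assoc (mk (xLeafL 0 3)), hZ1]
  simp only [seq_assoc]

/-- `√2 ⊗ 1/√2` in front of a `1 → 1` map. [cite: JeandelPerdrixVilmart2018, Appendix Lemma 5] -/
theorem sqrt_two_par_invSqrtTwo_par_one (A : ZXClass 1 1) : mk (dumbbell 0 0) ⊠ (mk invSqrtTwo ⊠ A) = A := by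
  rw [scalar_par_scalar_par, invSqrtTwo_par_sqrt_two_par_one]

/-- **The branch of Lemma 28 closes up**:
`((1/√2 ⊗ Z^{(0,0)}(-π/2)) ⊗ (Z(π) ⨾ xLeafL 0 (3π/4) ⨾ Z(π/4) ⨾ X(π/2) ⨾ Z(π))) ⨾ H = xLeafL 0 (π/4) ⨾ Z(π/4) ⨾ X(π/2) ⨾ Z(π)`
(Euler, two (K) flips). [cite: JeandelPerdrixVilmart2018, Appendix Lemma 28 (proof)] -/
theorem leafBranch_loop_seq_hBox :
    (mk invSqrtTwo ⊠ (mk (Z 0 0 (-2)) ⊠ (mk (Z 1 1 4) ⨟ mk (xLeafL 0 3) ⨟ mk (Z 1 1 1) ⨟ mk (X 1 1 2) ⨟ mk (Z 1 1 4)))) ⨟ mk hBox =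
      mk (xLeafL 0 1) ⨟ mk (Z 1 1 1) ⨟ mk (X 1 1 2) ⨟ mk (Z 1 1 4) := by
  -- the spine `xLeafL 0 (-π/4) Z(-π/4) X(π/2) Z(π) X(π)` with the scalar `(1/√2 ⊗ db 4 (-1))² = 1/√2 ⊗ db 4 (-2)`
  have h1 : (mk invSqrtTwo ⊠ (mk (Z 0 0 (-2)) ⊠ (mk (Z 1 1 4) ⨟ mk (xLeafL 0 3) ⨟ mk (Z 1 1 1) ⨟ mk (X 1 1 2) ⨟ mk (Z 1 1 4)))) ⨟ mk hBox =
      mk invSqrtTwo ⊠ (mk (dumbbell 4 (-2)) ⊠ (mk (xLeafL 0 (-1)) ⨟ (mk (Z 1 1 (-1)) ⨟ (mk (X 1 1 2) ⨟ (mk (Z 1 1 4) ⨟ mk (X 1 1 4)))))) := by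
    rw [Z_dot_neg_two_eq, scalar_par_seq_one, scalar_par_seq_one]
    simp only [seq_assoc]
    rw [Z_phase_seq_hBox, ← seq_assoc (mk (X 1 1 2)) (mk hBox), X_phase_seq_hBox, seq_assoc (mk hBox) (mk (Z 1 1 2)), hBox_eq_euler, Z_dot_neg_two_eq,
      scalar_par_seq_one, scalar_par_seq_one, seq_scalar_par_one, seq_scalar_par_one, seq_scalar_par_one, seq_scalar_par_one,
      seq_scalar_par_one, seq_scalar_par_one]
    simp only [seq_assoc]
    rw [← seq_assoc (mk (Z 1 1 2)) (mk (Z 1 1 2)), phase_seq_phase, ← seq_assoc (mk (Z 1 1 1)) (mk (Z 1 1 2)), phase_seq_phase,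
      ← seq_assoc (mk (Z 1 1 4)) (mk (xLeafL 0 3)), Z_pi_seq_xLeafL, seq_assoc (mk (xLeafL 0 (3 + 4))), ← seq_assoc (mk (Z 1 1 4)) (mk (Z 1 1 (1 + 2))),
      phase_seq_phase, show (3 : ZMod 8) + 4 = -1 from by decide, show (4 : ZMod 8) + (1 + 2) = -1 from by decide, show (2 : ZMod 8) + 2 = 4 from by decide,
      -- `(1/√2 ⊗ db 4 (-1))² = 1/√2 ⊗ db 4 (-2)`
      scalar_par_scalar_par (mk (dumbbell 4 (-1))) (mk invSqrtTwo),
      show ∀ Y : ZXClass 1 1, mk (dumbbell 4 (-1)) ⊠ (mk (dumbbell 4 (-1)) ⊠ Y) = (mk (dumbbell 4 (-1)) ⊠ mk (dumbbell 4 (-1))) ⊠ Y from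
        fun Y => (par_assoc' _ _ _).trans (cast_id _ _ _),
      dumbbell_four_mul, show (-1 : ZMod 8) + -1 = -2 from by decide,
      show ∀ Y : ZXClass 1 1, (mk (dumbbell 4 (-2)) ⊠ mk (dumbbell 0 0)) ⊠ Y = mk (dumbbell 4 (-2)) ⊠ (mk (dumbbell 0 0) ⊠ Y) from
        fun Y => (par_assoc _ _ _).trans (cast_id _ _ _),
      scalar_par_scalar_par (mk invSqrtTwo) (mk (dumbbell 4 (-2))), invSqrtTwo_par_sqrt_two_par_one]
  -- flip the leaf and the phase with `db 4 1 ⊗ db 4 1`, and `Z(π) X(π)` with `db 4 4`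
  have h2 : mk (dumbbell 4 1) ⊠ (mk (dumbbell 4 1) ⊠ (mk (dumbbell 4 4) ⊠ (mk (xLeafL 0 (-1)) ⨟ (mk (Z 1 1 (-1)) ⨟ (mk (X 1 1 2) ⨟ (mk (Z 1 1 4) ⨟ mk (X 1 1 4))))))) =
      mk (dumbbell 0 0) ⊠ (mk (dumbbell 0 0) ⊠ (mk (dumbbell 0 0) ⊠ (mk (xLeafL 0 1) ⨟ (mk (Z 1 1 1) ⨟ (mk (X 1 1 2) ⨟ mk (Z 1 1 4)))))) := by
    rw [scalar_par_scalar_par (mk (dumbbell 4 1)) (mk (dumbbell 4 4)), scalar_par_scalar_par (mk (dumbbell 4 1)) (mk (dumbbell 4 4)),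
      ← scalar_par_seq_one (mk (dumbbell 4 1)) (mk (xLeafL 0 (-1))), dumbbell_four_par_xLeafL_neg, zero_add (4 : ZMod 8), scalar_par_seq_one,
      scalar_par_scalar_par (mk (dumbbell 4 1)) (mk (dumbbell 0 0)), ← xLeafL_zero_seq_X_pi, seq_assoc, ← seq_scalar_par_one (mk (dumbbell 4 1)) (mk (xLeafL 0 1)),
      ← seq_assoc (mk (X 1 1 4)) (mk (Z 1 1 (-1))), ← scalar_par_seq_one (mk (dumbbell 4 1)) (mk (X 1 1 4) ⨟ mk (Z 1 1 (-1))),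
      ← sqrt_two_par_Z_phase_seq_X_pi, scalar_par_seq_one, seq_scalar_par_one, seq_assoc, ← seq_assoc (mk (X 1 1 4)) (mk (X 1 1 2)),
      xphase_seq_xphase, scalar_par_scalar_par (mk (dumbbell 4 4)) (mk (dumbbell 0 0)), scalar_par_scalar_par (mk (dumbbell 4 4)) (mk (dumbbell 0 0)),
      ← seq_scalar_par_one (mk (dumbbell 4 4)) (mk (xLeafL 0 1)), ← seq_scalar_par_one (mk (dumbbell 4 4)) (mk (Z 1 1 1)),
      ← seq_scalar_par_one (mk (dumbbell 4 4)) (mk (X 1 1 (4 + 2))),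
      show mk (dumbbell 4 4) ⊠ (mk (Z 1 1 4) ⨟ mk (X 1 1 4)) = mk (dumbbell 0 0) ⊠ (mk (X 1 1 4) ⨟ mk (Z 1 1 4)) from by
        rw [rule_K, show (-4 : ZMod 8) = 4 from by decide],
      seq_scalar_par_one, ← seq_assoc (mk (X 1 1 (4 + 2))) (mk (X 1 1 4)), xphase_seq_xphase, show (4 : ZMod 8) + 2 + 4 = 2 from by decide,
      seq_scalar_par_one, seq_scalar_par_one]
  refine cancel_dumbbell_four_one_one 4 (cancel_dumbbell_four_one_one 1 (cancel_dumbbell_four_one_one 1 ?_))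
  rw [h1, scalar_par_scalar_par (mk (dumbbell 4 4)) (mk invSqrtTwo), scalar_par_scalar_par (mk (dumbbell 4 4)) (mk (dumbbell 4 (-2))),
    scalar_par_scalar_par (mk (dumbbell 4 1)) (mk invSqrtTwo), scalar_par_scalar_par (mk (dumbbell 4 1)) (mk (dumbbell 4 (-2))),
    scalar_par_scalar_par (mk (dumbbell 4 1)) (mk invSqrtTwo), scalar_par_scalar_par (mk (dumbbell 4 1)) (mk (dumbbell 4 (-2))), h2,
    scalar_par_scalar_par (mk invSqrtTwo) (mk (dumbbell 4 (-2))), invSqrtTwo_par_sqrt_two_par_one]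
  simp only [seq_assoc]
  rw [show ∀ Y : ZXClass 1 1, mk (dumbbell 4 1) ⊠ (mk (dumbbell 4 4) ⊠ Y) = (mk (dumbbell 4 1) ⊠ mk (dumbbell 4 4)) ⊠ Y from fun Y => (par_assoc' _ _ _).trans (cast_id _ _ _),
    dumbbell_four_mul, show (1 : ZMod 8) + 4 = 5 from by decide,
    show ∀ Y : ZXClass 1 1, (mk (dumbbell 4 5) ⊠ mk (dumbbell 0 0)) ⊠ Y = mk (dumbbell 4 5) ⊠ (mk (dumbbell 0 0) ⊠ Y) from fun Y => (par_assoc _ _ _).trans (cast_id _ _ _),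
    show ∀ Y : ZXClass 1 1, mk (dumbbell 4 1) ⊠ (mk (dumbbell 4 5) ⊠ Y) = (mk (dumbbell 4 1) ⊠ mk (dumbbell 4 5)) ⊠ Y from fun Y => (par_assoc' _ _ _).trans (cast_id _ _ _),
    dumbbell_four_mul, show (1 : ZMod 8) + 5 = -2 from by decide,
    show ∀ Y : ZXClass 1 1, (mk (dumbbell 4 (-2)) ⊠ mk (dumbbell 0 0)) ⊠ Y = mk (dumbbell 4 (-2)) ⊠ (mk (dumbbell 0 0) ⊠ Y) from fun Y => (par_assoc _ _ _).trans (cast_id _ _ _)]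

/-- The green merge as a conjugated red merge: `Z^{(2,1)} = (H ⊗ H) ⨾ X^{(2,1)} ⨾ H`. [cite: JeandelPerdrixVilmart2018, Fig. 1 (H)] -/
theorem Z_merge_eq_conj : mk (Z 2 1 0) = (mk hBox ⊠ mk hBox) ⨟ mk (X 2 1 0) ⨟ mk hBox := by
  rw [X_merge_eq, ← seq_assoc, ← seq_assoc, interchange, hBox_seq_hBox, wires_par_wires, id_seq, seq_assoc, hBox_seq_hBox, seq_id]

/-- **Appendix Lemma 28** (`triangle-hadamard-parallel`): `√2 ⊗ (Z^{(1,2)} ⨾ (T ⊗ H) ⨾ Z^{(2,1)} ⨾ Z(π)) = T`.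
[cite: JeandelPerdrixVilmart2018, Appendix Lemma 28] -/
theorem triangle_hadamard_parallel :
    mk (dumbbell 0 0) ⊠ (mk (Z 1 2 0) ⨟ (mk triangle ⊠ mk hBox) ⨟ mk (Z 2 1 0) ⨟ mk (Z 1 1 4)) = mk triangle := by
  rw [Z_merge_eq_conj, ← seq_assoc _ ((mk hBox ⊠ mk hBox) ⨟ mk (X 2 1 0)) (mk hBox), ← seq_assoc _ (mk hBox ⊠ mk hBox) (mk (X 2 1 0)),
    seq_assoc (mk (Z 1 2 0)) (mk triangle ⊠ mk hBox) (mk hBox ⊠ mk hBox), interchange, hBox_seq_hBox, mk_triangle,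
    seq_assoc _ (mk (xLeafL 0 1)) (mk (Z 1 1 1)), seq_assoc _ (mk (xLeafL 0 1) ⨟ mk (Z 1 1 1)) (mk (X 1 1 2)), seq_par_wires, seq_par_wires,
    seq_assoc ((mk (Z 1 2 0) ⨟ (mk (wires 1) ⊠ (mk (X 1 2 0) ⨟ (mk (Z 1 0 (-1)) ⊠ mk (Z 1 0 (-1)))))) ⊠ mk (wires 1)), ← seq_assoc (mk (Z 1 2 0)) ((mk (Z 1 2 0) ⨟ (mk (wires 1) ⊠ (mk (X 1 2 0) ⨟ (mk (Z 1 0 (-1)) ⊠ mk (Z 1 0 (-1)))))) ⊠ mk (wires 1)), split_seq_gadget_par, ← seq_par_wires,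
    seq_assoc (mk (Z 1 2 0) ⨟ (mk (wires 1) ⊠ (mk (X 1 2 0) ⨟ (mk (Z 1 0 (-1)) ⊠ mk (Z 1 0 (-1)))))) (mk (Z 1 2 0)), seq_assoc (mk (Z 1 2 0) ⨟ (mk (wires 1) ⊠ (mk (X 1 2 0) ⨟ (mk (Z 1 0 (-1)) ⊠ mk (Z 1 0 (-1)))))) _ (mk (X 2 1 0)), seq_assoc (mk (Z 1 2 0) ⨟ (mk (wires 1) ⊠ (mk (X 1 2 0) ⨟ (mk (Z 1 0 (-1)) ⊠ mk (Z 1 0 (-1)))))) _ (mk hBox),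
    seq_assoc (mk (Z 1 2 0) ⨟ (mk (wires 1) ⊠ (mk (X 1 2 0) ⨟ (mk (Z 1 0 (-1)) ⊠ mk (Z 1 0 (-1)))))) _ (mk (Z 1 1 4)),
    ← seq_scalar_par_one, ← scalar_par_seq_one, ← scalar_par_seq_one, looped_leafBranch_hBox, leafBranch_loop_seq_hBox, seq_assoc _ (mk (Z 1 1 4)) (mk (Z 1 1 4)),
    phase_seq_phase, show (4 : ZMod 8) + 4 = 0 from by decide, Z_one_one, seq_id]

/-! ### Appendix Lemma 30: the triangle with a fork has swappable outputs -/

/-- **The CNOT with control on the second wire, drawn either way**: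
`(𝕀 ⊗ Z^{(1,2)}) ⨾ (X^{(2,1)} ⊗ 𝕀) = (X^{(1,2)} ⊗ 𝕀) ⨾ (𝕀 ⊗ Z^{(2,1)})`. [cite: JeandelPerdrixVilmart2018, §2.2] -/
theorem cnot21_eq : (mk (wires 1) ⊠ mk (Z 1 2 0)) ⨟ (mk (X 2 1 0) ⊠ mk (wires 1)) = (mk (X 1 2 0) ⊠ mk (wires 1)) ⨟ (mk (wires 1) ⊠ mk (Z 2 1 0)) := by
  rw [← spider_bend, wires_par_seq, seq_assoc, show mk (wires 1) ⊠ (mk (wires 1) ⊠ mk (Z 2 1 0)) = mk (wires 2) ⊠ mk (Z 2 1 0) from by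
      rw [← wires_par_wires 1 1]; exact (par_assoc' _ _ _).trans (cast_id _ _ _),
    show (mk (wires 2) ⊠ mk (Z 2 1 0)) ⨟ (mk (X 2 1 0) ⊠ mk (wires 1)) = (mk (X 2 1 0) ⊠ mk (wires 2)) ⨟ (mk (wires 1) ⊠ mk (Z 2 1 0)) from by
      rw [interchange, interchange, id_seq, seq_id, id_seq, seq_id],
    ← seq_assoc, show mk (wires 1) ⊠ (mk cup ⊠ mk (wires 1)) = (mk (wires 1) ⊠ mk cup) ⊠ mk (wires 1) from (par_assoc' _ _ _).trans (cast_id _ _ _),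
    ← wires_par_wires 1 1, show mk (X 2 1 0) ⊠ (mk (wires 1) ⊠ mk (wires 1)) = (mk (X 2 1 0) ⊠ mk (wires 1)) ⊠ mk (wires 1) from (par_assoc' _ _ _).trans (cast_id _ _ _),
    ← seq_par_wires, par_cup_seq_xmerge_par]

/-- **The CNOT with control on the first wire, drawn either way**:
`(Z^{(1,2)} ⊗ 𝕀) ⨾ (𝕀 ⊗ X^{(2,1)}) = (𝕀 ⊗ X^{(1,2)}) ⨾ (Z^{(2,1)} ⊗ 𝕀)`. [cite: JeandelPerdrixVilmart2018, §2.2] -/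
theorem cnot12_eq : (mk (Z 1 2 0) ⊠ mk (wires 1)) ⨟ (mk (wires 1) ⊠ mk (X 2 1 0)) = (mk (wires 1) ⊠ mk (X 1 2 0)) ⨟ (mk (Z 2 1 0) ⊠ mk (wires 1)) := by
  have h := congrArg (fun A => (transpose A).colorSwap) cnot21_eq
  simpa using h

/-- **(B2) on the other CNOT**: `(X^{(1,2)} ⊗ 𝕀) ⨾ (𝕀 ⊗ Z^{(2,1)}) = √2 ⊗ (CNOT ⨾ σ ⨾ CNOT)` with `CNOT = (Z^{(1,2)} ⊗ 𝕀) ⨾ (𝕀 ⊗ X^{(2,1)})`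
(the transposed colour swap of `rule_B2_cnot`). [cite: JeandelPerdrixVilmart2018, Fig. 1 (B2)] -/
theorem notC_eq : (mk (X 1 2 0) ⊠ mk (wires 1)) ⨟ (mk (wires 1) ⊠ mk (Z 2 1 0)) =
    mk (dumbbell 0 0) ⊠ (((mk (Z 1 2 0) ⊠ mk (wires 1)) ⨟ (mk (wires 1) ⊠ mk (X 2 1 0))) ⨟ mk swap ⨟ ((mk (Z 1 2 0) ⊠ mk (wires 1)) ⨟ (mk (wires 1) ⊠ mk (X 2 1 0)))) := by
  have h := congrArg (fun A => (transpose A).colorSwap) rule_B2_cnot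
  simp at h
  rw [cnot21_eq, ← cnot12_eq] at h
  rw [h, ← seq_assoc]

/-- **Appendix Lemma 29, divided**: `Z^{(1,2)} ⨾ (T ⊗ 𝕀) ⨾ X^{(2,1)} = 1/√2 ⊗ T`. [cite: JeandelPerdrixVilmart2018, Appendix Lemma 29] -/
theorem looped_triangle_div : mk (Z 1 2 0) ⨟ (mk triangle ⊠ mk (wires 1)) ⨟ mk (X 2 1 0) = mk invSqrtTwo ⊠ mk triangle := by
  have h := congrArg (mk invSqrtTwo ⊠ ·) looped_triangle
  simp only [invSqrtTwo_par_sqrt_two_par_one] at h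
  exact h

/-- **The fork and the mirrored fork are equal**:
`Z^{(1,2)} ⨾ (𝕀 ⊗ (T ⨾ Z^{(1,2)})) ⨾ (X^{(2,1)} ⊗ 𝕀) = Z^{(1,2)} ⨾ ((T ⨾ Z^{(1,2)}) ⊗ 𝕀) ⨾ (𝕀 ⊗ X^{(2,1)})` ((B2), Lemma 29).
[cite: JeandelPerdrixVilmart2018, Appendix Lemma 30 (proof)] -/
theorem fork_eq_mirror :
    mk (Z 1 2 0) ⨟ (mk (wires 1) ⊠ (mk triangle ⨟ mk (Z 1 2 0))) ⨟ (mk (X 2 1 0) ⊠ mk (wires 1)) =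
      mk (Z 1 2 0) ⨟ ((mk triangle ⨟ mk (Z 1 2 0)) ⊠ mk (wires 1)) ⨟ (mk (wires 1) ⊠ mk (X 2 1 0)) := by
  have hsw : (mk (wires 1) ⊠ mk triangle) ⨟ mk swap = mk swap ⨟ (mk triangle ⊠ mk (wires 1)) := by
    have h := wires_par_seq_fswap1 (mk triangle)
    simp only [fswap1_one] at h
    exact h
  have hsym : mk (Z 1 2 0) ⨟ (mk (wires 1) ⊠ mk triangle) ⨟ mk (X 2 1 0) = mk invSqrtTwo ⊠ mk triangle := by
    rw [show mk (Z 1 2 0) ⨟ (mk (wires 1) ⊠ mk triangle) = mk (Z 1 2 0) ⨟ (mk triangle ⊠ mk (wires 1)) ⨟ mk swap from by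
        rw [seq_assoc, ← swap_seq_par_phase, ← seq_assoc, Z_seq_swap],
      seq_assoc, swap_seq_X, looped_triangle_div]
  rw [wires_par_seq, seq_assoc, seq_assoc (mk (wires 1) ⊠ mk triangle), cnot21_eq, notC_eq, two_two_seq_scalar_par, one_two_seq_scalar_par_two,
    ← seq_assoc (mk (wires 1) ⊠ mk triangle) (((mk (Z 1 2 0) ⊠ mk (wires 1)) ⨟ (mk (wires 1) ⊠ mk (X 2 1 0))) ⨟ mk swap) ((mk (Z 1 2 0) ⊠ mk (wires 1)) ⨟ (mk (wires 1) ⊠ mk (X 2 1 0))), ← seq_assoc (mk (wires 1) ⊠ mk triangle) ((mk (Z 1 2 0) ⊠ mk (wires 1)) ⨟ (mk (wires 1) ⊠ mk (X 2 1 0))) (mk swap),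
    ← seq_assoc (mk (wires 1) ⊠ mk triangle) (mk (Z 1 2 0) ⊠ mk (wires 1)) (mk (wires 1) ⊠ mk (X 2 1 0)),
    show (mk (wires 1) ⊠ mk triangle) ⨟ (mk (Z 1 2 0) ⊠ mk (wires 1)) = (mk (Z 1 2 0) ⊠ mk (wires 1)) ⨟ (mk (wires 2) ⊠ mk triangle) from by
      rw [← par_eq_seq_right, par_eq_seq_left],
    ← seq_assoc (mk (Z 1 2 0)) _ ((mk (Z 1 2 0) ⊠ mk (wires 1)) ⨟ (mk (wires 1) ⊠ mk (X 2 1 0))), ← seq_assoc (mk (Z 1 2 0)) _ (mk swap), ← seq_assoc (mk (Z 1 2 0)) _ (mk (wires 1) ⊠ mk (X 2 1 0)),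
    ← seq_assoc (mk (Z 1 2 0)) (mk (Z 1 2 0) ⊠ mk (wires 1)) (mk (wires 2) ⊠ mk triangle), Z_seq_Z_par 1 1 1 2 le_rfl, add_zero (0 : ZMod 8),
    show mk (Z 1 3 0) = mk (Z 1 2 0) ⨟ (mk (wires 1) ⊠ mk (Z 1 2 0)) from by rw [Z_seq_par_Z 1 1 1 2 le_rfl, add_zero (0 : ZMod 8)],
    seq_assoc (mk (Z 1 2 0)) (mk (wires 1) ⊠ mk (Z 1 2 0)) (mk (wires 2) ⊠ mk triangle), ← wires_par_wires 1 1,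
    show (mk (wires 1) ⊠ mk (wires 1)) ⊠ mk triangle = mk (wires 1) ⊠ (mk (wires 1) ⊠ mk triangle) from (par_assoc _ _ _).trans (cast_id _ _ _),
    ← wires_par_seq, seq_assoc (mk (Z 1 2 0)) _ (mk (wires 1) ⊠ mk (X 2 1 0)), ← wires_par_seq, hsym,
    show mk (wires 1) ⊠ (mk invSqrtTwo ⊠ mk triangle) = mk invSqrtTwo ⊠ (mk (wires 1) ⊠ mk triangle) from by
      rw [show mk (wires 1) ⊠ (mk invSqrtTwo ⊠ mk triangle) = (mk (wires 1) ⊠ mk invSqrtTwo) ⊠ mk triangle from (par_assoc' _ _ _).trans (cast_id _ _ _),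
        ← scalar_par_one_comm]; exact (par_assoc _ _ _).trans (cast_id _ _ _),
    one_two_seq_scalar_par_two, scalar_par_one_two_seq_two', scalar_par_one_two_seq_two', sqrt_two_par_invSqrtTwo_par_one_two,
    seq_assoc (mk (Z 1 2 0)) (mk (wires 1) ⊠ mk triangle) (mk swap), hsw, ← seq_assoc (mk (Z 1 2 0)) (mk swap), Z_seq_swap,
    ← seq_assoc _ (mk (Z 1 2 0) ⊠ mk (wires 1)) (mk (wires 1) ⊠ mk (X 2 1 0)), seq_assoc (mk (Z 1 2 0)) (mk triangle ⊠ mk (wires 1)) (mk (Z 1 2 0) ⊠ mk (wires 1)),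
    ← seq_par_wires]
  where
  two_two_seq_scalar_par (A : ZXClass 2 2) (s : ZXClass 0 0) (B : ZXClass 2 2) : A ⨟ (s ⊠ B) = s ⊠ (A ⨟ B) := by
    rw [scalar_par_seq_right, empty_par, cast_id]
  scalar_par_one_two_seq_two' (s : ZXClass 0 0) (A : ZXClass 1 2) (B : ZXClass 2 2) : (s ⊠ A) ⨟ B = s ⊠ (A ⨟ B) := by
    rw [scalar_par_seq_left, empty_par, cast_id]
  sqrt_two_par_invSqrtTwo_par_one_two (A : ZXClass 1 2) : mk (dumbbell 0 0) ⊠ (mk invSqrtTwo ⊠ A) = A := by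
    rw [show mk (dumbbell 0 0) ⊠ (mk invSqrtTwo ⊠ A) = (mk (dumbbell 0 0) ⊠ mk invSqrtTwo) ⊠ A from (par_assoc' _ _ _).trans (cast_id _ _ _),
      scalar_par_comm, invSqrtTwo_par_dumbbell, empty_par, cast_id]

/-- **Appendix Lemma 30** (`black-dot-swappable-outputs`): the fork `Z^{(1,2)} ⨾ (𝕀 ⊗ (T ⨾ Z^{(1,2)})) ⨾ (X^{(2,1)} ⊗ 𝕀)`
has swappable outputs. [cite: JeandelPerdrixVilmart2018, Appendix Lemma 30] -/
theorem fork_seq_swap :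
    (mk (Z 1 2 0) ⨟ (mk (wires 1) ⊠ (mk triangle ⨟ mk (Z 1 2 0))) ⨟ (mk (X 2 1 0) ⊠ mk (wires 1))) ⨟ mk swap =
      mk (Z 1 2 0) ⨟ (mk (wires 1) ⊠ (mk triangle ⨟ mk (Z 1 2 0))) ⨟ (mk (X 2 1 0) ⊠ mk (wires 1)) := by
  have hA : (mk triangle ⨟ mk (Z 1 2 0)) ⨟ mk swap = mk triangle ⨟ mk (Z 1 2 0) := by rw [seq_assoc, Z_seq_swap]
  conv_lhs => rw [fork_eq_mirror, seq_assoc, ← fswap1_one, wires_par_seq_fswap1, fswap1_two, seq_assoc (mk swap ⊠ mk (wires 1)),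
    ← seq_assoc (mk (Z 1 2 0) ⨟ ((mk triangle ⨟ mk (Z 1 2 0)) ⊠ mk (wires 1))), seq_assoc (mk (Z 1 2 0)) _ (mk swap ⊠ mk (wires 1)),
    ← seq_par_wires, hA]
  conv_rhs => rw [show mk (Z 1 2 0) ⨟ (mk (wires 1) ⊠ (mk triangle ⨟ mk (Z 1 2 0))) = (mk (Z 1 2 0) ⨟ mk swap) ⨟ (mk (wires 1) ⊠ (mk triangle ⨟ mk (Z 1 2 0)))
      from by rw [Z_seq_swap], seq_assoc (mk (Z 1 2 0)) (mk swap), ← bswap1_one, bswap1_seq_wires_par, bswap1_two,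
    ← seq_assoc ((mk triangle ⨟ mk (Z 1 2 0)) ⊠ mk (wires 1)), ← seq_assoc (mk (Z 1 2 0)), seq_assoc _ (mk swap ⊠ mk (wires 1)) (mk (X 2 1 0) ⊠ mk (wires 1)),
    ← seq_par_wires, swap_seq_X, ← seq_assoc (mk (Z 1 2 0)), seq_assoc _ (mk (wires 1) ⊠ mk swap) (mk (X 2 1 0) ⊠ mk (wires 1))]

end ZXClass

end Literature.Computability.QuantumComplexity
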